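import Summits.QuantumFields.BalabanUV.Beta.E3GenericReflection
import Summits.QuantumFields.BalabanUV.Beta.VertexSandwichTransport
import Summits.QuantumFields.BalabanUV.Beta.RelInvSandwich
import Summits.QuantumFields.BalabanUV.Beta.CoDressedMmRead
import Summits.QuantumFields.BalabanUV.Beta.ValueJetGeneric
import Summits.QuantumFields.BalabanUV.Beta.DiagonalContactLoc

/-!
# Beta / E3CoDressedContact — the contact of the dressed `e3`-reflection law over a relative inverse, EVALUATED, level-generically
# (β sub-cell, row D1, hR leaf (L3) re-typed (L3-D′); unit `b2b-balaban-beta-an3` gen 30, node «E3-CONTACT-EVAL»; file 1 of 2)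

HONEST FRAMING.  Discharging `BetaPertH` makes Balaban's ultraviolet stability UNCONDITIONAL — a real constructive-QFT result; it
is NOT the continuum limit and NOT the Clay problem.  HONEST DEPENDENCY: continuum YM on `T⁴` ⇐ `BetaPertH` ∧ nine spine estimates
(0/9 proved); `BetaPertH` ⇐ (D1) ∧ (D4) ∧ CAP+tail.  This module is NOT (D1) and NOT `BetaPertH`: it is neutral kernel algebra over
the tree's own definitions ([folklore]); nothing here is a cited fact, no definition is introduced.

WHAT IS EVALUATED.  `VertexSandwichTransport.sandwichLaw_ff_iff` (p210437) reduces the reflection law of a `K`-generic value-function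
jet `e3OfK Lc K S κ′ u′ = −mmRead Lc (K ∘ vertexOfK K Lc S κ′ u′ ∘ K)` under `bref α` — for a local stencil family `S` obeying the
(Sr-conj) law with contact family `C κ u := conjV 𝕄 (γ • diagK (ctGen d α Lc κ u))` — to ONE evaluation: the field–field block of
`−mmRead Lc (K ∘ vertexOfK K Lc C κ′ u′ ∘ K)`.  This module evaluates it for every RELATIVE INVERSE `K` of a `σ`-bordered `𝕄`:

* §1 `sandwich_conjV_smul_diagK`: for `RelInv A 𝕄 (axEc ρ N)` (`A`, `𝕄` spread) and a localised diagonal symbol,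
  `A ∘ conjV 𝕄 (γ • diagK g) ∘ A = −conjV A (diagK (γ·g))` (`ChartConjugationRelative.sandwich_conjV_rel` + `comp_axEc_diagK_comm`);
  `summable_colH_mul_linKerAt` (decaying × bounded).
* §2 the `ℋ`-dressed generator `Gᵛ_{K,μ,y} p c := Σ_κ Σ'_u colH K Lc μ y κ u · ctGen d α Lc κ u p c`: `diagK Gᵛ = vertexOfK K Lc (κ u ↦
  diagK (ctGen d α Lc κ u)) μ y`, hence `Loc (diagK Gᵛ)` for spread `K` (`biLoc_diagK_ctGen`, `vertexFamily_vertexOfK'`).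
* §3 THE LEVEL-GENERIC LAW (row owner's request, journal 2026-08-20T07:39Z): for ANY spread `K` with `refK (Φ Lc α) K = K` and
  `RelInv K 𝕄 (axEc ρ_c Lc)`, `𝕄` spread with multiplier–field block `σ ·` that of `bhKAt d ρ_c Lc` (`σ ≠ 0`) and multiplier block `0`,
  and ANY local stencil family `S` with `S κ (bref α κ u) = ε • refK (Φ Lc α) (S κ u + conjV 𝕄 (γ • diagK (ctGen d α Lc κ u)))`:
  `e3OfK Lc K S κ′ (bref α κ′ u′) =ff= ε·s_a·s_b·(e3OfK Lc K S κ′ u′ (r x) (r z) + (γ/(σ·Lc^{d+1}))·conjV (mmRead Lc K) (diagK (ctGen d α Lc κ′ u′)) (r x) (r z))`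
  (`e3OfK_bref_inl_inl_of_law`).  Engine: RULE `(E∘𝕄)∘A = E` of `RelInv` READ ON A COARSE MULTIPLIER ENTRY with a `σ`-border
  (`sum_tsum_colH_mul_linKerAt_of_EMA_border`: `Σ_κ Σ'_w colH A N μ′ y κ w · linKerAt ρ N m z′ (κ, w) = [z′ = y ∧ m = μ′]·(σ·N^{d+1})⁻¹`),
  whence the dressed generator at coarse multiplier legs is the BARE generator's field leg (`dressedGenK_zsmul_inr`) and the field–field
  block of the contact is `(γ/(σ·Lc^{d+1})) · conjV (mmRead Lc K) (diagK ctGen)` (`contactK_inl_inl`); with a substitute `𝕄⁺`,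
  `mmRead Lc K =ff= τ·𝕄⁺`, the coefficient is `γ·τ/(σ·Lc^{d+1})` (`e3OfK_bref_inl_inl_of_law'`, adapter `conjV_diagK_inl_inl_of_ff`).
  Level 1 — `(K, 𝕄, σ, S, γ) = (coDressKBmAt ρ_c Lc KInv, bhKAt d ρ_c Lc, 1, S0NAt, cVH/Lc^{d+1})` in closed form — is file 2,
  `E3CoDressedContactLevelOne`; level `j+1` of the recursive literal, `(G_j, bhKStepAt j, stepScale j, SrecAt j, γ_j)` with
  `𝕄⁺ = bhKStepAt (j+1)`, `τ = (wVH (j+1))⁻¹`, is the row owner's instantiation (`SpineRecursiveClosed`), not done here.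

All declarations `[folklore]`; axioms standard.  Provenance: b2b-balaban β sub-cell, unit beta-an3 gen 30, 2026-08-20 (v2 = v1 split in
two files ≤ 400 lines, declarations and names unchanged); over `E3GenericReflection`, `VertexSandwichTransport` (an3 gen 29), `RelInvSandwich`,
`CoDressedMmRead`, `ValueJetGeneric` (an2 gen 15), `BorderedHessianRooted`, `AxialDressingRootedBmKernel`, `DiagonalContactLoc` BY NAME;
no existing file touched.
-/

open Finset
open scoped BigOperators
open Literature.Probability.LatticeModels (Torus.proj)
open Literature.MathematicalPhysics.QuantumFieldTheory
open Literature.MathematicalPhysics.QuantumFieldTheory.Balaban1983to89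
open Literature.MathematicalPhysics.QuantumFieldTheory.Balaban1983to89.Beta
open B12Sec2to5 (l1 l1_nonneg)
open ExpKernelCalculus (MKer comp Decays BiLoc VertexFamily summable_exp_shift')
open PolarizationSign (reflSign)
open KernelReflection (LegMap refK refK_apply)
open ResolventReflection (bref Φ refK_KInv)
open OneStepResolventKernel (Fib KInv LocStencil wsum proj_zsmul quo_zsmul)
open OneStepKernelFamily (colH vertexOfK vertexFamily_vertexOfK' abs_colH_le)
open BalabanStepJetsSucc (mmRead mmRead_inl_inl)
open AffineAveraging (box toSite)
open AveragingContours (blk off)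
open AveragingContoursRooted (ctr ctrOff ctrOff_mem_box linAvgAt)
open AveragingHessianKernels (ell)
open AveragingHessianKernelsRooted (linKerAt abs_linKerAt_le)
open RootedKernelReflection (off_zsmul)
open AxialProjector (blk_zsmul)
open KKTFluctuationKernel (delta1)
open LatticeForm (quo)
open Summit.QuantumFields.BalabanUV.Beta.ChartConjugation (conjV)
open Summit.QuantumFields.BalabanUV.Beta.ChartConjugationRelative (RelInv sandwich_conjV_rel)
open Summit.QuantumFields.BalabanUV.Beta.BorderedHessian (bhKAt bhKAt_inr_inl bhKAt_inr_inr ctGen ctGen_inl ctGen_inr diagK diagK_apply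
  conjV_diagK_apply comp_axEc_diagK_comm linAvgAt_delta1_eq_pow_mul_linKerAt spr_bhKAt relInv_coDressKBmAt_KInv_bhKAt biLoc_diagK_ctGen cCT)
open Summit.QuantumFields.BalabanUV.Beta.AxialDressingRooted (axEc axEc_inr_inr comp_axEc_apply spr_axEc coDressKBmAt spr_coDressKBmAt
  refK_coDressKBmAt coDressKBmAt_inr_inr mmRead_coDressKBmAt)
open Summit.QuantumFields.BalabanUV.Beta.SpineRooted (S0NAt e3OfK e3OfK_apply conjV_smul_right)
open Summit.QuantumFields.BalabanUV.Beta.TameKernelCalculus (Spr Loc)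
open Summit.QuantumFields.BalabanUV.Beta.VertexReflectionContact (smul_diagK mmRead_neg vertexOfK_conjV_diagK summable_colH_mul_ctGen)
open Summit.QuantumFields.BalabanUV.Beta.E3GenericReflection (e3KLaw_ff_iff)
open Summit.QuantumFields.BalabanUV.Beta.VertexSandwichTransport (sandwichLaw_ff_iff)

noncomputable section

namespace Summit.QuantumFields.BalabanUV.Beta.E3CoDressedContact

variable {d : ℕ}

/-! ## §1 The relative-inverse sandwich of a scaled diagonal contact -/

section Generic

variable {A M : MKer (d + 1) (Fib d)}

/-- [folklore] **`A ∘ conjV 𝕄 (γ • diagK g) ∘ A = −conjV A (diagK (γ·g))`** for `RelInv A 𝕄 (axEc ρ N)`, `A` and `𝕄` spread and the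
diagonal kernel `diagK g` localised: `ChartConjugationRelative.sandwich_conjV_rel` with `E := axEc ρ N`, which commutes with every
diagonal kernel (`BorderedHessian.comp_axEc_diagK_comm`); the scalar is folded into the symbol (`VertexReflectionContact.smul_diagK`). -/
theorem sandwich_conjV_smul_diagK (ρ : Fin (d + 1) → ℤ) (N : ℕ) (hA : Spr A) (hM : Spr M) (hR : RelInv A M (axEc ρ N)) (γ : ℝ)
    {g : (Fin (d + 1) → ℤ) → Fib d → ℝ} (hg : Loc (diagK g)) :
    comp (comp A (conjV M (γ • diagK g))) A = -conjV A (diagK fun p c => γ * g p c) := by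
  have hg' : Loc (diagK fun p c => γ * g p c) := by
    rw [← smul_diagK]
    exact hg.smul γ
  rw [smul_diagK]
  exact sandwich_conjV_rel hA hM (spr_axEc ρ N) hR hg' (comp_axEc_diagK_comm _ ρ N)

/-- [folklore] **THE VERTEX WEIGHTS OF A DECAYING KERNEL AGAINST THE ROOTED LINEARISED KERNEL ARE SUMMABLE** (decaying × bounded,
`AveragingHessianKernelsRooted.abs_linKerAt_le`). -/
theorem summable_colH_mul_linKerAt {N Lc : ℕ} {K : MKer (d + 1) (Fib d)} (hK : ∃ δ C : ℝ, 0 < δ ∧ 0 ≤ C ∧ Decays K C δ)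
    (hLc : 1 ≤ Lc) {r : Fin (d + 1) → ℕ} (hr : r ∈ box (d + 1) Lc) (μ : Fin (d + 1)) (y : Fin (d + 1) → ℤ) (κ m : Fin (d + 1))
    (z' : Fin (d + 1) → ℤ) : Summable fun u => colH K N μ y κ u * linKerAt (toSite r) Lc m z' (κ, u) := by
  obtain ⟨δK, C, hδK, hC, h⟩ := hK
  refine Summable.of_norm_bounded (((summable_exp_shift' hδK ((N : ℤ) • y)).mul_left C).mul_right (ell (d + 1) Lc : ℝ))
    (fun u => ?_)
  rw [Real.norm_eq_abs, abs_mul]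
  exact mul_le_mul (abs_colH_le (N := N) h μ y κ u) (abs_linKerAt_le hLc m z' hr (κ, u)) (abs_nonneg _)
    (mul_nonneg hC (Real.exp_pos _).le)

end Generic

/-! ## §2 The `ℋ`-dressed generator of a spread weight kernel: its diagonal kernel is a chain-rule vertex, hence localised -/

section DressedGen

variable {Lc : ℕ} [NeZero Lc]

omit [NeZero Lc] in
/-- [folklore] **THE DIAGONAL KERNEL OF THE `ℋ`-DRESSED GENERATOR IS THE CHAIN-RULE VERTEX OF THE DIAGONAL GENERATOR STENCIL**
`κ u ↦ diagK (ctGen d α Lc κ u)` (entrywise; no summability needed). -/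
theorem diagK_dressedGen_eq_vertexOfK (K : MKer (d + 1) (Fib d)) (N : ℕ) (α μ : Fin (d + 1)) (y : Fin (d + 1) → ℤ) :
    diagK (fun p c => ∑ κ, ∑' u, colH K N μ y κ u * ctGen d α Lc κ u p c) =
      vertexOfK K N (fun κ u => diagK (ctGen d α Lc κ u)) μ y := by
  classical
  funext x z a b
  simp only [vertexOfK, OneStepResolventKernel.wsum, diagK_apply]
  by_cases h : x = z ∧ a = b
  · simp only [if_pos h]
  · simp only [if_neg h, mul_zero, tsum_zero, Finset.sum_const_zero]

/-- [folklore] **THE DIAGONAL KERNEL OF THE `ℋ`-DRESSED GENERATOR IS LOCALISED**, for any spread weight kernel `K`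
(`OneStepKernelFamily.vertexFamily_vertexOfK'` over `BorderedHessian.biLoc_diagK_ctGen`). -/
theorem loc_diagK_dressedGen {K : MKer (d + 1) (Fib d)} (hK : Spr K) (α μ : Fin (d + 1)) (y : Fin (d + 1) → ℤ) :
    Loc (diagK (fun p c => ∑ κ, ∑' u, colH K Lc μ y κ u * ctGen d α Lc κ u p c)) := by
  rw [diagK_dressedGen_eq_vertexOfK]
  have hS : LocStencil (fun κ u => diagK (ctGen d α Lc κ u)) (cCT d Lc 1) 1 := fun κ u => biLoc_diagK_ctGen α Lc κ u zero_le_one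
  obtain ⟨Cv, δv, hδv, hV⟩ := vertexFamily_vertexOfK' (N := Lc) (E3GenericReflection.Spr.decays' hK) hS one_pos
  exact ⟨_, _, Cv, δv, hδv, hV μ y⟩

end DressedGen

/-! ## §3 THE LEVEL-GENERIC FORM (row owner's request, journal 2026-08-20T07:39Z, decision (L3-D′))

Any spread reflection-invariant `K` with `RelInv K 𝕄 (axEc ρ_c Lc)`, `𝕄` spread with multiplier–field block `σ ·` that of
`bhKAt d ρ_c Lc` (`σ ≠ 0`) and multiplier block `0`, and any local stencil family `S` obeying the (Sr-conj) law with contact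
`conjV 𝕄 (γ • diagK (ctGen d α Lc κ u))`.  Level 1 (file 2, `E3CoDressedContactLevelOne`) is the instance `(K, 𝕄, σ, S, γ) := (Ĝ, bhKAt d ρ_c Lc, 1, S0NAt, cVH/Lc^{d+1})`;
level `j+1` of the recursive literal is, in the row owner's dictionary, `(G_j, bhKStepAt j, stepScale j, SrecAt j, γ_j)` — instantiated
and consumed by the row owner (`bhKStepAt_succ_mf/_mm`, `spr_bhKStepAt`, `relInv_coDressKBmAt_KInvStep_bhKStepAt`,
`refK_coDressKBmAt_KInvStep`, `locStencil_SrecAt` BY NAME), not here. -/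

section LevelGeneric

variable {A 𝕄 : MKer (d + 1) (Fib d)}

/-- [folklore] **RULE `E ∘ 𝕄 ∘ A = E` READ ON A COARSE MULTIPLIER ENTRY, BORDER SCALED BY `σ`.**  For a spread `A`, a kernel `𝕄`
whose multiplier–field block is `σ ·` that of `bhKAt d ρ N` and whose multiplier block vanishes, and `(axEc ρ N ∘ 𝕄) ∘ A = axEc ρ N`
(`ρ = toSite r` in-block): `Σ_κ Σ'_w colH A N μ′ y κ w · linKerAt ρ N m z′ (κ, w) = [z′ = y ∧ m = μ′] · (σ·N^{d+1})^{−1}`. -/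
theorem sum_tsum_colH_mul_linKerAt_of_EMA_border {N : ℕ} [NeZero N] {r : Fin (d + 1) → ℕ} (hr : r ∈ box (d + 1) N) (hA : Spr A)
    (σ : ℝ) (hσ : σ ≠ 0)
    (h𝕄mf : ∀ (x y : Fin (d + 1) → ℤ) (κ l : Fin (d + 1)),
      𝕄 x y (Sum.inr κ) (Sum.inl l) = σ * bhKAt d (toSite r) N x y (Sum.inr κ) (Sum.inl l))
    (h𝕄mm : ∀ (x y : Fin (d + 1) → ℤ) (κ l : Fin (d + 1)), 𝕄 x y (Sum.inr κ) (Sum.inr l) = 0)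
    (hEMA : comp (comp (axEc (toSite r) N) 𝕄) A = axEc (toSite r) N) (m μ' : Fin (d + 1)) (z' y : Fin (d + 1) → ℤ) :
    ∑ κ, ∑' w, colH A N μ' y κ w * linKerAt (toSite r) N m z' (κ, w) =
      if z' = y ∧ m = μ' then (σ * (N : ℝ) ^ (d + 1))⁻¹ else 0 := by
  classical
  have hN1 : 1 ≤ N := Nat.one_le_iff_ne_zero.mpr (NeZero.ne N)
  have hσN : σ * (N : ℝ) ^ (d + 1) ≠ 0 := mul_ne_zero hσ (pow_ne_zero _ (by exact_mod_cast NeZero.ne N))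
  have hsum : ∀ κ, Summable fun w => colH A N μ' y κ w * linKerAt (toSite r) N m z' (κ, w) :=
    fun κ => summable_colH_mul_linKerAt (E3GenericReflection.Spr.decays' hA) hN1 hr μ' y κ m z'
  have h : (∑' w, ∑ f, comp (axEc (toSite r) N) 𝕄 ((N : ℤ) • z') w (Sum.inr m) f * A w ((N : ℤ) • y) f (Sum.inr μ')) =
      axEc (toSite r) N ((N : ℤ) • z') ((N : ℤ) • y) (Sum.inr m) (Sum.inr μ') :=
    congrFun (congrFun (congrFun (congrFun hEMA ((N : ℤ) • z')) ((N : ℤ) • y)) (Sum.inr m)) (Sum.inr μ')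
  simp only [comp_axEc_apply, proj_zsmul, if_true, Fintype.sum_sum_type, h𝕄mf, h𝕄mm, bhKAt_inr_inl, zero_mul,
    Finset.sum_const_zero, add_zero, quo_zsmul, linAvgAt_delta1_eq_pow_mul_linKerAt, axEc_inr_inr, and_true] at h
  have hinj : ((N : ℤ) • z' = (N : ℤ) • y) ↔ z' = y :=
    ⟨fun h' => by simpa only [quo_zsmul] using congrArg (quo N) h', fun h' => by rw [h']⟩
  have hkey : ∀ L a : ℝ, a * L = (σ * (N : ℝ) ^ (d + 1))⁻¹ * (σ * ((N : ℝ) ^ (d + 1) * L) * a) := fun L a => by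
    rw [show σ * ((N : ℝ) ^ (d + 1) * L) * a = (σ * (N : ℝ) ^ (d + 1)) * (a * L) by ring, inv_mul_cancel_left₀ hσN]
  have h2 : ∑' w, ∑ κ, colH A N μ' y κ w * linKerAt (toSite r) N m z' (κ, w) =
      (σ * (N : ℝ) ^ (d + 1))⁻¹ * (if (N : ℤ) • z' = (N : ℤ) • y ∧ m = μ' then 1 else 0) := by
    rw [← h, ← tsum_mul_left]
    refine tsum_congr fun w => ?_
    rw [Finset.mul_sum]
    refine Finset.sum_congr rfl fun κ _ => ?_
    simp only [colH]
    exact hkey _ _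
  rw [Summable.tsum_finsetSum (fun κ _ => hsum κ)] at h2
  rw [h2]
  simp only [hinj]
  split_ifs <;> simp

/-- [folklore] Field–field entries of diagonal contacts through two kernels with proportional field–field blocks are proportional
(the adapter for a bordered `𝕄⁺` whose field block is a multiple of that of `mmRead Lc K`, e.g. `bhKStepAt (j+1)` vs `E2 (j+1)`). -/
theorem conjV_diagK_inl_inl_of_ff {𝕄₁ 𝕄₂ : MKer (d + 1) (Fib d)} (τ : ℝ)
    (h : ∀ (x z : Fin (d + 1) → ℤ) (a b : Fin (d + 1)), 𝕄₁ x z (Sum.inl a) (Sum.inl b) = τ * 𝕄₂ x z (Sum.inl a) (Sum.inl b))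
    (g : (Fin (d + 1) → ℤ) → Fib d → ℝ) (x z : Fin (d + 1) → ℤ) (a b : Fin (d + 1)) :
    conjV 𝕄₁ (diagK g) x z (Sum.inl a) (Sum.inl b) = τ * conjV 𝕄₂ (diagK g) x z (Sum.inl a) (Sum.inl b) := by
  rw [conjV_diagK_apply, conjV_diagK_apply, h]
  ring

variable {Lc : ℕ} [NeZero Lc] {K : MKer (d + 1) (Fib d)}

/-- [folklore] **THE `ℋ`-DRESSED GENERATOR OF A RELATIVE INVERSE AT A COARSE MULTIPLIER LEG IS THE BARE GENERATOR'S FIELD LEG,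
SCALED BY `(σ·Lc^{d+1})^{−1}`** (generic `K`; rule 4 of `RelInv K 𝕄 (axEc ρ_c Lc)` with a `σ`-bordered `𝕄`). -/
theorem dressedGenK_zsmul_inr (hLc : 1 ≤ Lc) (hKs : Spr K) (σ : ℝ) (hσ : σ ≠ 0)
    (h𝕄mf : ∀ (x y : Fin (d + 1) → ℤ) (κ l : Fin (d + 1)),
      𝕄 x y (Sum.inr κ) (Sum.inl l) = σ * bhKAt d (ctr (d + 1) Lc) Lc x y (Sum.inr κ) (Sum.inl l))
    (h𝕄mm : ∀ (x y : Fin (d + 1) → ℤ) (κ l : Fin (d + 1)), 𝕄 x y (Sum.inr κ) (Sum.inr l) = 0)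
    (hEMA : comp (comp (axEc (ctr (d + 1) Lc) Lc) 𝕄) K = axEc (ctr (d + 1) Lc) Lc)
    (α μ : Fin (d + 1)) (y z' : Fin (d + 1) → ℤ) (m : Fin (d + 1)) :
    ∑ κ, ∑' u, colH K Lc μ y κ u * ctGen d α Lc κ u ((Lc : ℤ) • z') (Sum.inr m) =
      (σ * (Lc : ℝ) ^ (d + 1))⁻¹ * ctGen d α Lc μ y z' (Sum.inl m) := by
  classical
  simp only [ctGen_inr, ctGen_inl, off_zsmul, blk_zsmul hLc, and_true]
  by_cases hm : m = α
  · simp only [hm, if_true, mul_neg, tsum_neg, Finset.sum_neg_distrib]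
    have hE : ∑ κ, ∑' u, colH K Lc μ y κ u * linKerAt (ctr (d + 1) Lc) Lc α z' (κ, u) =
        if z' = y ∧ α = μ then (σ * (Lc : ℝ) ^ (d + 1))⁻¹ else 0 :=
      sum_tsum_colH_mul_linKerAt_of_EMA_border (r := ctrOff (d + 1) Lc) (ctrOff_mem_box hLc) hKs σ hσ h𝕄mf h𝕄mm hEMA α μ z' y
    rw [hE]
    by_cases h2 : z' = y ∧ α = μ
    · rw [if_pos h2, if_pos ⟨h2.1, h2.2, h2.2.symm⟩, mul_neg, mul_one]
    · have h2' : ¬(z' = y ∧ α = μ ∧ μ = α) := fun h' => h2 ⟨h'.1, h'.2.1⟩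
      rw [if_neg h2, if_neg h2', neg_zero, mul_zero]
  · have h2' : ¬(z' = y ∧ m = μ ∧ μ = α) := fun h' => hm (h'.2.1.trans h'.2.2)
    simp only [hm, if_false, mul_zero, tsum_zero, Finset.sum_const_zero, if_neg h2']

/-- [folklore] **THE CONTACT OF A DRESSED LAW OVER A RELATIVE INVERSE IS THE `mm`-READ OF A DIAGONAL CONTACT CONJUGATED BY `K`**
(generic): `−mmRead Lc (K ∘ conjV 𝕄 (γ • diagK Gᵛ_K) ∘ K) = mmRead Lc (conjV K (diagK (γ·Gᵛ_K)))`. -/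
theorem neg_mmRead_contactK_sandwich (hKs : Spr K) (hM : Spr 𝕄) (hR : RelInv K 𝕄 (axEc (ctr (d + 1) Lc) Lc)) (γ : ℝ)
    (α μ : Fin (d + 1)) (y : Fin (d + 1) → ℤ) :
    -mmRead Lc (comp (comp K (conjV 𝕄 (γ • diagK (fun p c => ∑ κ, ∑' u, colH K Lc μ y κ u * ctGen d α Lc κ u p c)))) K) =
      mmRead Lc (conjV K (diagK fun p c => γ * ∑ κ, ∑' u, colH K Lc μ y κ u * ctGen d α Lc κ u p c)) := by
  rw [sandwich_conjV_smul_diagK (ctr (d + 1) Lc) Lc hKs hM hR γ (loc_diagK_dressedGen hKs α μ y), mmRead_neg, neg_neg]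

/-- [folklore] Its field–field entries: `γ · K (Lc•x′) (Lc•z′) (inr a) (inr b) · (Gᵛ_K (Lc•z′) (inr b) − Gᵛ_K (Lc•x′) (inr a))`. -/
theorem neg_mmRead_contactK_sandwich_inl_inl (hKs : Spr K) (hM : Spr 𝕄) (hR : RelInv K 𝕄 (axEc (ctr (d + 1) Lc) Lc))
    (γ : ℝ) (α μ : Fin (d + 1)) (y x' z' : Fin (d + 1) → ℤ) (a b : Fin (d + 1)) :
    (-mmRead Lc (comp (comp K (conjV 𝕄 (γ • diagK (fun p c => ∑ κ, ∑' u, colH K Lc μ y κ u * ctGen d α Lc κ u p c)))) K))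
        x' z' (Sum.inl a) (Sum.inl b) =
      γ * (K ((Lc : ℤ) • x') ((Lc : ℤ) • z') (Sum.inr a) (Sum.inr b) *
        ((∑ κ, ∑' u, colH K Lc μ y κ u * ctGen d α Lc κ u ((Lc : ℤ) • z') (Sum.inr b)) -
          ∑ κ, ∑' u, colH K Lc μ y κ u * ctGen d α Lc κ u ((Lc : ℤ) • x') (Sum.inr a))) := by
  rw [neg_mmRead_contactK_sandwich hKs hM hR γ α μ y, mmRead_inl_inl, conjV_diagK_apply]
  ring

/-- [folklore] **THE FIELD–FIELD BLOCK OF THE CONTACT, GENERIC**: with a `σ`-bordered `𝕄`,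
`(−mmRead Lc (K ∘ conjV 𝕄 (γ • diagK Gᵛ_{K,μ,y}) ∘ K)) x′ z′ (inl a) (inl b)
   = (γ/(σ·Lc^{d+1})) · conjV (mmRead Lc K) (diagK (ctGen d α Lc μ y)) x′ z′ (inl a) (inl b)`. -/
theorem contactK_inl_inl (hLc : 1 ≤ Lc) (hKs : Spr K) (hM : Spr 𝕄) (hR : RelInv K 𝕄 (axEc (ctr (d + 1) Lc) Lc)) (σ : ℝ)
    (hσ : σ ≠ 0)
    (h𝕄mf : ∀ (x y : Fin (d + 1) → ℤ) (κ l : Fin (d + 1)),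
      𝕄 x y (Sum.inr κ) (Sum.inl l) = σ * bhKAt d (ctr (d + 1) Lc) Lc x y (Sum.inr κ) (Sum.inl l))
    (h𝕄mm : ∀ (x y : Fin (d + 1) → ℤ) (κ l : Fin (d + 1)), 𝕄 x y (Sum.inr κ) (Sum.inr l) = 0)
    (γ : ℝ) (α μ : Fin (d + 1)) (y x' z' : Fin (d + 1) → ℤ) (a b : Fin (d + 1)) :
    (-mmRead Lc (comp (comp K (conjV 𝕄 (γ • diagK (fun p c => ∑ κ, ∑' u, colH K Lc μ y κ u * ctGen d α Lc κ u p c)))) K))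
        x' z' (Sum.inl a) (Sum.inl b) =
      γ / (σ * (Lc : ℝ) ^ (d + 1)) * conjV (mmRead Lc K) (diagK (ctGen d α Lc μ y)) x' z' (Sum.inl a) (Sum.inl b) := by
  rw [neg_mmRead_contactK_sandwich_inl_inl hKs hM hR γ α μ y, dressedGenK_zsmul_inr hLc hKs σ hσ h𝕄mf h𝕄mm hR.EMA α μ y z' b,
    dressedGenK_zsmul_inr hLc hKs σ hσ h𝕄mf h𝕄mm hR.EMA α μ y x' a, conjV_diagK_apply, mmRead_inl_inl]
  ring

omit [NeZero Lc] in
/-- [folklore] **THE CHAIN-RULE VERTEX OF THE SCALED DIAGONAL-CONTACT FAMILY IS THE SCALED DIAGONAL CONTACT OF THE DRESSED GENERATOR**: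
`vertexOfK K Lc (κ u ↦ conjV 𝕄 (γ • diagK (ctGen d α Lc κ u))) μ y = conjV 𝕄 (γ • diagK Gᵛ_{K,μ,y})`
(`VertexReflectionContact.vertexOfK_conjV_diagK`, scalar through the symbol). -/
theorem vertexOfK_conjV_smul_diagK_ctGen (hLc : 1 ≤ Lc) (hKs : Spr K) (𝕄' : MKer (d + 1) (Fib d)) (γ : ℝ) (α μ : Fin (d + 1))
    (y : Fin (d + 1) → ℤ) :
    vertexOfK K Lc (fun κ u => conjV 𝕄' (γ • diagK (ctGen d α Lc κ u))) μ y =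
      conjV 𝕄' (γ • diagK (fun p c => ∑ κ, ∑' u, colH K Lc μ y κ u * ctGen d α Lc κ u p c)) := by
  have hKd := E3GenericReflection.Spr.decays' hKs
  have hgs : ∀ (μ : Fin (d + 1)) (y : Fin (d + 1) → ℤ) (κ : Fin (d + 1)) (p : Fin (d + 1) → ℤ) (c : Fib d),
      Summable fun u => colH K Lc μ y κ u * (γ * ctGen d α Lc κ u p c) :=
    fun μ y κ p c => ((summable_colH_mul_ctGen hKd hLc α μ y κ p c).mul_left γ).congr fun u => by ring
  have hGen : (fun p c => ∑ κ, ∑' u, colH K Lc μ y κ u * (γ * ctGen d α Lc κ u p c))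
      = fun p c => γ * ∑ κ, ∑' u, colH K Lc μ y κ u * ctGen d α Lc κ u p c := by
    funext p c
    rw [Finset.mul_sum]
    refine Finset.sum_congr rfl fun κ _ => ?_
    rw [← tsum_mul_left]
    exact tsum_congr fun u => by ring
  have h1 : (fun κ u => conjV 𝕄' (γ • diagK (ctGen d α Lc κ u))) =
      fun κ u => conjV 𝕄' (diagK fun p c => γ * ctGen d α Lc κ u p c) := by
    funext κ u
    rw [smul_diagK]
  rw [h1, vertexOfK_conjV_diagK _ _ Lc _ hgs μ y, hGen, smul_diagK]

/-- [folklore] **THE LEVEL-GENERIC HEADLINE.**  Let `K` be spread with `refK (Φ Lc α) K = K` and `RelInv K 𝕄 (axEc ρ_c Lc)`, `𝕄`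
spread with multiplier–field block `σ ·` that of `bhKAt d ρ_c Lc` (`σ ≠ 0`) and multiplier block `0`, and let the local stencil
family `S` obey the (Sr-conj) law `S κ (bref α κ u) = ε • refK (Φ Lc α) (S κ u + conjV 𝕄 (γ • diagK (ctGen d α Lc κ u)))`.  Then the
`K`-generic value-function jet `e3OfK Lc K S` obeys, on field–field entries,
`e3 κ′ (bref α κ′ u′) x z (inl a) (inl b) = ε · (s_a s_b · (e3 κ′ u′ (r_a x) (r_b z) (inl a) (inl b)
   + (γ/(σ·Lc^{d+1})) · conjV (mmRead Lc K) (diagK (ctGen d α Lc κ′ u′)) (r_a x) (r_b z) (inl a) (inl b)))`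
(`VertexSandwichTransport.sandwichLaw_ff_iff` + `vertexOfK_conjV_smul_diagK_ctGen` + `contactK_inl_inl`). -/
theorem e3OfK_bref_inl_inl_of_law (hLc : 1 ≤ Lc) (hKs : Spr K) {α : Fin (d + 1)} (hKr : refK (Φ (d := d) Lc α) K = K)
    (hM : Spr 𝕄) (hR : RelInv K 𝕄 (axEc (ctr (d + 1) Lc) Lc)) (σ : ℝ) (hσ : σ ≠ 0)
    (h𝕄mf : ∀ (x y : Fin (d + 1) → ℤ) (κ l : Fin (d + 1)),
      𝕄 x y (Sum.inr κ) (Sum.inl l) = σ * bhKAt d (ctr (d + 1) Lc) Lc x y (Sum.inr κ) (Sum.inl l))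
    (h𝕄mm : ∀ (x y : Fin (d + 1) → ℤ) (κ l : Fin (d + 1)), 𝕄 x y (Sum.inr κ) (Sum.inr l) = 0)
    {S : Fin (d + 1) → (Fin (d + 1) → ℤ) → MKer (d + 1) (Fib d)} {Cs δ : ℝ} (hS : LocStencil S Cs δ) (hδ : 0 < δ) (γ : ℝ)
    (hSr : ∀ κ u, S κ (bref α κ u) =
      reflSign α κ • refK (Φ (d := d) Lc α) (S κ u + conjV 𝕄 (γ • diagK (ctGen d α Lc κ u))))
    (κ' : Fin (d + 1)) (u' x z : Fin (d + 1) → ℤ) (a b : Fin (d + 1)) :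
    e3OfK Lc K S κ' (bref α κ' u') x z (Sum.inl a) (Sum.inl b) =
      reflSign α κ' * ((Φ (d := d) Lc α).s (Sum.inl a) * (Φ (d := d) Lc α).s (Sum.inl b) *
        (e3OfK Lc K S κ' u' ((Φ (d := d) Lc α).r (Sum.inl a) x) ((Φ (d := d) Lc α).r (Sum.inl b) z) (Sum.inl a) (Sum.inl b) +
          γ / (σ * (Lc : ℝ) ^ (d + 1)) *
            conjV (mmRead Lc K) (diagK (ctGen d α Lc κ' u')) ((Φ (d := d) Lc α).r (Sum.inl a) x)
              ((Φ (d := d) Lc α).r (Sum.inl b) z) (Sum.inl a) (Sum.inl b))) := by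
  have hlaw := (sandwichLaw_ff_iff (N := Lc) hS hδ hSr hKs hKr κ' u'
    (fun p q e f => γ / (σ * (Lc : ℝ) ^ (d + 1)) * conjV (mmRead Lc K) (diagK (ctGen d α Lc κ' u')) p q e f)).2
    (fun x' z' a' b' => by
      rw [vertexOfK_conjV_smul_diagK_ctGen hLc hKs 𝕄 γ α κ' u']
      exact contactK_inl_inl hLc hKs hM hR σ hσ h𝕄mf h𝕄mm γ α κ' u' x' z' a' b') x z a b
  simp only [e3OfK_apply]
  simpa only [Pi.neg_apply] using hlaw

/-- [folklore] The same with a substitute `𝕄⁺` for `mmRead Lc K` on the field block (`mmRead Lc K =ff= τ · 𝕄⁺`): coefficient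
`γ·τ/(σ·Lc^{d+1})` (`conjV_diagK_inl_inl_of_ff`). -/
theorem e3OfK_bref_inl_inl_of_law' (hLc : 1 ≤ Lc) (hKs : Spr K) {α : Fin (d + 1)} (hKr : refK (Φ (d := d) Lc α) K = K)
    (hM : Spr 𝕄) (hR : RelInv K 𝕄 (axEc (ctr (d + 1) Lc) Lc)) (σ : ℝ) (hσ : σ ≠ 0)
    (h𝕄mf : ∀ (x y : Fin (d + 1) → ℤ) (κ l : Fin (d + 1)),
      𝕄 x y (Sum.inr κ) (Sum.inl l) = σ * bhKAt d (ctr (d + 1) Lc) Lc x y (Sum.inr κ) (Sum.inl l))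
    (h𝕄mm : ∀ (x y : Fin (d + 1) → ℤ) (κ l : Fin (d + 1)), 𝕄 x y (Sum.inr κ) (Sum.inr l) = 0)
    {S : Fin (d + 1) → (Fin (d + 1) → ℤ) → MKer (d + 1) (Fib d)} {Cs δ : ℝ} (hS : LocStencil S Cs δ) (hδ : 0 < δ) (γ : ℝ)
    (hSr : ∀ κ u, S κ (bref α κ u) =
      reflSign α κ • refK (Φ (d := d) Lc α) (S κ u + conjV 𝕄 (γ • diagK (ctGen d α Lc κ u))))
    {𝕄' : MKer (d + 1) (Fib d)} (τ : ℝ)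
    (h𝕄' : ∀ (x z : Fin (d + 1) → ℤ) (a b : Fin (d + 1)),
      mmRead Lc K x z (Sum.inl a) (Sum.inl b) = τ * 𝕄' x z (Sum.inl a) (Sum.inl b))
    (κ' : Fin (d + 1)) (u' x z : Fin (d + 1) → ℤ) (a b : Fin (d + 1)) :
    e3OfK Lc K S κ' (bref α κ' u') x z (Sum.inl a) (Sum.inl b) =
      reflSign α κ' * ((Φ (d := d) Lc α).s (Sum.inl a) * (Φ (d := d) Lc α).s (Sum.inl b) *
        (e3OfK Lc K S κ' u' ((Φ (d := d) Lc α).r (Sum.inl a) x) ((Φ (d := d) Lc α).r (Sum.inl b) z) (Sum.inl a) (Sum.inl b) +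
          γ * τ / (σ * (Lc : ℝ) ^ (d + 1)) *
            conjV 𝕄' (diagK (ctGen d α Lc κ' u')) ((Φ (d := d) Lc α).r (Sum.inl a) x)
              ((Φ (d := d) Lc α).r (Sum.inl b) z) (Sum.inl a) (Sum.inl b))) := by
  rw [e3OfK_bref_inl_inl_of_law hLc hKs hKr hM hR σ hσ h𝕄mf h𝕄mm hS hδ γ hSr κ' u' x z a b,
    conjV_diagK_inl_inl_of_ff τ h𝕄']
  ring

end LevelGeneric

end Summit.QuantumFields.BalabanUV.Beta.E3CoDressedContact

end
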